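import Summits.PneNP.PneNP.Theorems.ConstantBand.Negative.LoadBearing
import Summits.PneNP.PneNP.Theorems.SingleThreshold.Negative.Locality
import Summits.PneNP.PneNP.Theorems.SliceACZero.Negative.DeltaBeforeK
import Literature.Computability.Complexity.CliqueThresholdBounds

/-!
# Route OneSlice, crux `SliceTarget` (stmt-PneNP-2832), line `Sketch-ideator3-r1`: the SUB-THRESHOLD locality floor
# (assembly from the generalized fibre stubs)

`Theorems/OneSliceSliceTargetTransfer.lean` proves the locality floor at `k = 4` for circuits reading `≤ 3n` slots, which
is what the integer exponents `c ≤ 1` of the crux need. (This file does not import it — the farm had not built that module when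
this one was written — so the window bookkeeping is redone here in the packaged form `window_general`.) The same fibre argument runs as long as the read set `F` is a small
fraction of the THRESHOLD edge count `m_k(n) = thr k n` (so that every fibre's free part is still a near-central slice of an
almost complete slot set). This file is the assembly step of that sharper floor, from the generalized fibre bounds
(hypotheses `hLow`, `hUp`: the registered stubs T3/T4 with `#F ≤ 3n` replaced by `8·#F ≤ thr k n`, landed separately) and
the landed T1 (`stub_sliceTouch`, any `F`) and T2 (`stub_fibreMin`):

`sliceLB_subthreshold_of`: for every `k ≥ 3` there is `δ > 0` such that eventually, on every central slice, every
`δ`-accurate `{∧₂,∨₂}`-circuit has `thr k n ≤ 16·size + 8`, i.e. size `≥ m_k(n)/16 − 1/2 = Ω(n^{2−2/(k−1)})`.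

Consequence for the line skeleton: the open stub T7 may be restricted to circuits in the size window
`[m_k(n)/16, n^c]` — below it accuracy is impossible by locality; the crux's content is exactly that window.
Lead prover-line-stmt-PneNP-2832-0, 2026-08-16.
-/

set_option linter.dupNamespace false

namespace Summit.PneNP.PneNP.Cruxes.SliceTarget.Ideator3Line

open Literature.Computability.Complexity Finset Filter Classical
open scoped Topology
open Summit.PneNP.PneNP.Theorems.ConstantBand.Negative (Edge thr Central slice errSet)
open Summit.PneNP.PneNP.Theorems.SingleThreshold.Negative (Edges Touch zeroOn inputList eval_congr
  length_inputList_le arity_le_two_of_isOver touch_of_ne pc pc_nonneg pc_le_one tendsto_pc pc_pow_choose)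
open Summit.PneNP.PneNP.Theorems.SliceACZero.Negative (sliceCard sliceCard_eq)

noncomputable section

/-- **Window package, general `k ≥ 3`.** Eventually in `n`, for every central `j`: `C(k,2) ≤ j ≤ C(n,2)`,
`j / C(n,2) ≤ 2·n^{-2/(k-1)}`, `16 ≤ thr k n` and `0 < C(n,2)` (threshold `m = thr k n = ⌊C(n,2)·p⌋₊ ≥ (n−1)/2 − 1 → ∞`;
central `j ∈ [m − m^{3/4}, m + m^{3/4}] ⊆ [m/2, 2m]` once `m ≥ 16`; `m ≤ C(n,2)·p`, `p ≤ 1/2`). [folklore] -/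
theorem window_general {k : ℕ} (hk : 3 ≤ k) : ∀ᶠ n : ℕ in atTop, ∀ j : ℕ, Central k n j →
    k.choose 2 ≤ j ∧ j ≤ n.choose 2 ∧ (j : ℝ) / (n.choose 2 : ℕ) ≤ 2 * pc n k ∧ 16 ≤ thr k n ∧ 0 < n.choose 2 := by
  have hk2 : 2 ≤ k := by omega
  have hpc : ∀ᶠ n : ℕ in atTop, pc n k ≤ 1 / 2 :=
    (tendsto_pc hk2).eventually (eventually_le_nhds (by norm_num))
  filter_upwards [hpc, eventually_ge_atTop (4 * k.choose 2 + 40)] with n hp hn j hj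
  have hn1 : 1 ≤ n := by omega
  have hn1r : (1 : ℝ) ≤ n := by exact_mod_cast hn1
  have hN : 0 < n.choose 2 := Nat.choose_pos (by omega)
  have hNr : (0 : ℝ) < (n.choose 2 : ℕ) := by exact_mod_cast hN
  -- `thr ≥ (n-1)/2 - 1` (adapted from Cruxes/SliceTarget/Disproof.lean `thr_ge`)
  have hthr_ge : ((n : ℝ) - 1) / 2 - 1 ≤ thr k n := by
    have hinv : (n : ℝ)⁻¹ ≤ pc n k := by
      rw [pc, ← Real.rpow_neg_one]
      apply Real.rpow_le_rpow_of_exponent_le hn1r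
      have hk' : (3 : ℝ) ≤ k := by exact_mod_cast hk
      rw [neg_div, neg_le_neg_iff, div_le_one (by linarith)]
      linarith
    have hT : ((n : ℝ) - 1) / 2 ≤ (n.choose 2 : ℕ) * pc n k := by
      have hn0 : (n : ℝ) ≠ 0 := by exact_mod_cast (show n ≠ 0 by omega)
      calc ((n : ℝ) - 1) / 2 = (n.choose 2 : ℕ) * (n : ℝ)⁻¹ := by
            rw [Nat.cast_choose_two]; field_simp
        _ ≤ _ := mul_le_mul_of_nonneg_left hinv (Nat.cast_nonneg _)
    have hfl := Nat.lt_floor_add_one (((n.choose 2 : ℕ) : ℝ) * (n : ℝ) ^ (-(2 : ℝ) / ((k : ℝ) - 1)))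
    rw [thr]
    rw [pc] at hT
    linarith
  have hthr : (2 * (k.choose 2 : ℝ) + 16) ≤ thr k n := by
    have h40 : (4 * (k.choose 2 : ℝ) + 40) ≤ n := by exact_mod_cast hn
    linarith
  have hK0 : (0 : ℝ) ≤ k.choose 2 := Nat.cast_nonneg _
  have hthr16 : (16 : ℝ) ≤ thr k n := by linarith
  have hthr' : 16 ≤ thr k n := by exact_mod_cast hthr16
  -- central bounds: `thr/2 ≤ j ≤ 2 thr` (adapted from Cruxes/SliceTarget/Disproof.lean `central_bounds`)
  have hpow : (thr k n : ℝ) ^ ((3 : ℝ) / 4) ≤ thr k n / 2 := by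
    have h0 : (0 : ℝ) ≤ thr k n := by linarith
    have hq : (2 : ℝ) ≤ (thr k n : ℝ) ^ ((1 : ℝ) / 4) := by
      have h16' : (16 : ℝ) = 2 ^ (4 : ℝ) := by norm_num
      calc (2 : ℝ) = ((2 : ℝ) ^ (4 : ℝ)) ^ ((1 : ℝ) / 4) := by
            rw [← Real.rpow_mul (by norm_num)]; norm_num
        _ ≤ (thr k n : ℝ) ^ ((1 : ℝ) / 4) := by
            apply Real.rpow_le_rpow (by norm_num) _ (by norm_num)
            rw [← h16']; exact hthr16
    have hsplit : (thr k n : ℝ) = (thr k n : ℝ) ^ ((3 : ℝ) / 4) * (thr k n : ℝ) ^ ((1 : ℝ) / 4) := by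
      rw [← Real.rpow_add' h0 (by norm_num)]
      norm_num
    have h34 : 0 ≤ (thr k n : ℝ) ^ ((3 : ℝ) / 4) := Real.rpow_nonneg h0 _
    nlinarith
  obtain ⟨hlo', hhi'⟩ := abs_sub_le_iff.1 hj
  have hlo : (thr k n : ℝ) / 2 ≤ j := by linarith
  have hhi : (j : ℝ) ≤ 2 * thr k n := by linarith
  have hTle : (thr k n : ℝ) ≤ (n.choose 2 : ℕ) * pc n k := by
    rw [thr, pc]
    exact Nat.floor_le (mul_nonneg (Nat.cast_nonneg _) (Real.rpow_nonneg (Nat.cast_nonneg _) _))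
  have hjle : (j : ℝ) ≤ 2 * ((n.choose 2 : ℕ) * pc n k) := hhi.trans (by linarith)
  refine ⟨?_, ?_, ?_, hthr', hN⟩
  · have : (k.choose 2 : ℝ) ≤ j := by linarith
    exact_mod_cast this
  · have : (j : ℝ) ≤ (n.choose 2 : ℕ) := by nlinarith
    exact_mod_cast this
  · rw [div_le_iff₀ hNr]
    linarith

/-- The touching budget under `8·|F| ≤ m_k(n)`: `|F| · C(n−2,k−2) · (2 n^{-2/(k-1)})^{C(k,2)} ≤ 2^{C(k,2)} · n^{-2/(k-1)}`
(`n ≥ 2`), using `m_k(n) ≤ C(n,2)·p ≤ n²p/2`, `C(n−2,k−2) ≤ n^{k−2}`, `p^{C(k,2)} = n^{-k}`. [folklore] -/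
theorem touchBudget_sub {n k : ℕ} (hn : 2 ≤ n) (hk : 2 ≤ k) {F : Finset (Edge n)} (hF : 8 * #F ≤ thr k n) :
    (#F : ℝ) * ((n - 2).choose (k - 2) : ℕ) * (2 * pc n k) ^ (k.choose 2) ≤ 2 ^ (k.choose 2) * pc n k := by
  have hn1 : 1 ≤ n := by omega
  have hn0 : (0 : ℝ) < n := by exact_mod_cast (show 0 < n by omega)
  have hp0 : 0 ≤ pc n k := pc_nonneg n k
  have hpK : pc n k ^ (k.choose 2) = ((n : ℝ) ^ k)⁻¹ := pc_pow_choose hn1 hk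
  -- `|F| ≤ thr ≤ N p ≤ n² p / 2`
  have hFle : (#F : ℝ) ≤ (n : ℝ) ^ 2 / 2 * pc n k := by
    have h1 : (8 * #F : ℝ) ≤ thr k n := by exact_mod_cast hF
    have h2 : (thr k n : ℝ) ≤ (n.choose 2 : ℕ) * pc n k := by
      rw [thr, pc]
      exact Nat.floor_le (mul_nonneg (Nat.cast_nonneg _) (Real.rpow_nonneg (Nat.cast_nonneg _) _))
    have h3 : ((n.choose 2 : ℕ) : ℝ) ≤ (n : ℝ) ^ 2 / 2 := by
      rw [Nat.cast_choose_two]; nlinarith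
    have h4 : ((n.choose 2 : ℕ) : ℝ) * pc n k ≤ (n : ℝ) ^ 2 / 2 * pc n k :=
      mul_le_mul_of_nonneg_right h3 hp0
    have h5 : (0 : ℝ) ≤ #F := Nat.cast_nonneg _
    linarith
  -- `C(n-2,k-2) ≤ n^{k-2}`
  have hC : (((n - 2).choose (k - 2) : ℕ) : ℝ) ≤ (n : ℝ) ^ (k - 2) := by
    have ha : (n - 2).choose (k - 2) ≤ (n - 2) ^ (k - 2) := Nat.choose_le_pow _ _
    have hb : (n - 2) ^ (k - 2) ≤ n ^ (k - 2) := Nat.pow_le_pow_left (Nat.sub_le n 2) _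
    exact_mod_cast ha.trans hb
  have hC0 : (0 : ℝ) ≤ (((n - 2).choose (k - 2) : ℕ) : ℝ) := Nat.cast_nonneg _
  have hnk : (n : ℝ) ^ k = (n : ℝ) ^ (k - 2) * (n : ℝ) ^ 2 := by
    rw [← pow_add]; congr 1; omega
  rw [mul_pow, hpK]
  calc (#F : ℝ) * ((n - 2).choose (k - 2) : ℕ) * ((2 : ℝ) ^ (k.choose 2) * ((n : ℝ) ^ k)⁻¹)
      ≤ ((n : ℝ) ^ 2 / 2 * pc n k) * (n : ℝ) ^ (k - 2) * ((2 : ℝ) ^ (k.choose 2) * ((n : ℝ) ^ k)⁻¹) := by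
        have : (0 : ℝ) ≤ (2 : ℝ) ^ (k.choose 2) * ((n : ℝ) ^ k)⁻¹ := by positivity
        gcongr
    _ = 2 ^ (k.choose 2) * pc n k / 2 := by
        rw [hnk]
        field_simp
    _ ≤ 2 ^ (k.choose 2) * pc n k := by
        have : (0 : ℝ) ≤ 2 ^ (k.choose 2) * pc n k := by positivity
        linarith

/-- **Sub-threshold locality floor (assembly).** From T1 (slice touching bound), T2 (fibre decoupling) and the fibre
clique bounds for read sets with `8·|F| ≤ m_k(n)` (lower bound with density `α`, upper bound `1/2`): for every `k ≥ 3` there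
is `δ > 0` such that eventually, on every central slice `j`, every `δ`-accurate `{∧₂,∨₂}`-circuit satisfies
`m_k(n) ≤ 16·size + 8` — a circuit with fewer gates reads `≤ 2·size + 1 ≤ m_k(n)/8` slots `F`, is constant on each fibre over
`F` while `CLIQUE_k(x ∖ F)` is not (T2 with `α₀ = min α 1/2`), and differs from `CLIQUE_k` off the touching event, of
density `≤ 2^{C(k,2)} n^{-2/(k-1)} → 0`. [folklore] -/
theorem sliceLB_subthreshold_of
    (hTouch : ∀ (n k j : ℕ) (F : Finset (Edge n)), k.choose 2 ≤ j → j ≤ n.choose 2 →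
      (#((slice n j).filter fun x => Touch n k F x) : ℝ) ≤
        (#F : ℝ) * ((n - 2).choose (k - 2) : ℝ) * (((j : ℝ) / (n.choose 2 : ℕ)) ^ (k.choose 2)) * #(slice n j))
    (hFib : ∀ (n j : ℕ) (F : Finset (Edge n)) (f g : (Edge n → Bool) → Bool) (α : ℝ),
      (∀ x y : Edge n → Bool, (∀ e ∈ F, x e = y e) → f x = f y) →
      (∀ (ρ : Edge n → Bool) (b : Bool),
        α * #((slice n j).filter fun x => ∀ e ∈ F, x e = ρ e) ≤
          #((slice n j).filter fun x => (∀ e ∈ F, x e = ρ e) ∧ g x = b)) →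
      α * #(slice n j) ≤ #((slice n j).filter fun x => f x ≠ g x))
    (hLow : ∀ k : ℕ, 3 ≤ k → ∃ α : ℝ, 0 < α ∧ ∀ᶠ n : ℕ in atTop, ∀ j : ℕ, Central k n j →
      ∀ F : Finset (Edge n), 8 * #F ≤ thr k n → ∀ ρ : Edge n → Bool,
        α * #((slice n j).filter fun x => ∀ e ∈ F, x e = ρ e) ≤
          #((slice n j).filter fun x => (∀ e ∈ F, x e = ρ e) ∧ cliqueFn n k (zeroOn F x) = true))
    (hUp : ∀ k : ℕ, 3 ≤ k → ∀ᶠ n : ℕ in atTop, ∀ j : ℕ, Central k n j →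
      ∀ F : Finset (Edge n), 8 * #F ≤ thr k n → ∀ ρ : Edge n → Bool,
        (1 / 2 : ℝ) * #((slice n j).filter fun x => ∀ e ∈ F, x e = ρ e) ≤
          #((slice n j).filter fun x => (∀ e ∈ F, x e = ρ e) ∧ cliqueFn n k (zeroOn F x) = false))
    {k : ℕ} (hk : 3 ≤ k) :
    ∃ δ : ℝ, 0 < δ ∧ ∀ᶠ n : ℕ in atTop, ∀ j : ℕ, Central k n j → ∀ C : Circuit (Edge n),
      C.IsOver monotoneBasis → (#(errSet n k j C) : ℝ) ≤ δ * #(slice n j) → thr k n ≤ 16 * C.size + 8 := by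
  have hk3 : 3 ≤ k := hk
  have hk2 : 2 ≤ k := by omega
  obtain ⟨α, hα, hLowk⟩ := hLow k hk
  have hUpk := hUp k hk3
  set α₀ : ℝ := min α (1 / 2) with hα₀
  have hα₀pos : 0 < α₀ := lt_min hα (by norm_num)
  have hα₀α : α₀ ≤ α := min_le_left _ _
  have hα₀h : α₀ ≤ 1 / 2 := min_le_right _ _
  -- the touching budget vanishes
  have hτ : ∀ᶠ n : ℕ in atTop, (2 : ℝ) ^ (k.choose 2) * pc n k ≤ α₀ / 2 := by
    have h := (tendsto_pc hk2).const_mul ((2 : ℝ) ^ (k.choose 2))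
    rw [mul_zero] at h
    exact h.eventually (eventually_le_nhds (by positivity))
  refine ⟨α₀ / 4, by positivity, ?_⟩
  filter_upwards [hLowk, hUpk, window_general hk3, hτ, eventually_ge_atTop 2] with n hL hU hW hτn hn2
  intro j hj C hC herr
  obtain ⟨hKj, hjN, hjq, _h16, hN⟩ := hW j hj
  by_contra hsize
  push Not at hsize
  -- the slots `C` reads
  set F : Finset (Edge n) := (inputList C).toFinset with hFdef
  have hFmem : ∀ i ∈ inputList C, i ∈ F := fun i hi => List.mem_toFinset.2 hi
  have hFcard : 8 * #F ≤ thr k n := by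
    have h1 : #F ≤ (inputList C).length := List.toFinset_card_le _
    have h2 := length_inputList_le C (arity_le_two_of_isOver hC)
    omega
  -- `f` = the circuit, `g` = the `F`-blind clique indicator
  set f : (Edge n → Bool) → Bool := fun x => C.eval x with hfdef
  set g : (Edge n → Bool) → Bool := fun x => cliqueFn n k (zeroOn F x) with hgdef
  have hf : ∀ x y : Edge n → Bool, (∀ e ∈ F, x e = y e) → f x = f y :=
    fun x y hxy => eval_congr C fun i hi => hxy i (hFmem i hi)
  have hfibre : ∀ (ρ : Edge n → Bool) (b : Bool),
      α₀ * #((slice n j).filter fun x => ∀ e ∈ F, x e = ρ e) ≤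
        #((slice n j).filter fun x => (∀ e ∈ F, x e = ρ e) ∧ g x = b) := by
    intro ρ b
    have hΦ : (0 : ℝ) ≤ #((slice n j).filter fun x => ∀ e ∈ F, x e = ρ e) := Nat.cast_nonneg _
    cases b
    · exact (mul_le_mul_of_nonneg_right hα₀h hΦ).trans (hU j hj F hFcard ρ)
    · exact (mul_le_mul_of_nonneg_right hα₀α hΦ).trans (hL j hj F hFcard ρ)
  have hdec : α₀ * #(slice n j) ≤ #((slice n j).filter fun x => f x ≠ g x) := hFib n j F f g α₀ hf hfibre
  -- `{f ≠ g} ⊆ errSet ∪ Touch`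
  have hsub : ((slice n j).filter fun x => f x ≠ g x) ⊆
      errSet n k j C ∪ (slice n j).filter fun x => Touch n k F x := by
    intro x hx
    rw [mem_filter] at hx
    obtain ⟨hxs, hne⟩ := hx
    rw [mem_union]
    by_cases hE : C.eval x ≠ cliqueFn n k x
    · left
      exact mem_filter.2 ⟨mem_univ _, (mem_filter.1 hxs).2, hE⟩
    · right
      push Not at hE
      refine mem_filter.2 ⟨hxs, touch_of_ne F x ?_⟩
      intro hzg
      apply hne
      simp only [hfdef, hgdef]
      rw [hE, hzg]
  have hcard : (#((slice n j).filter fun x => f x ≠ g x) : ℝ) ≤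
      #(errSet n k j C) + #((slice n j).filter fun x => Touch n k F x) := by
    have := (card_le_card hsub).trans (card_union_le _ _)
    exact_mod_cast this
  -- the touching term
  have hS0 : (0 : ℝ) ≤ #(slice n j) := Nat.cast_nonneg _
  have htouch : (#((slice n j).filter fun x => Touch n k F x) : ℝ) ≤ α₀ / 2 * #(slice n j) := by
    have h1 := hTouch n k j F hKj hjN
    have hq0 : (0 : ℝ) ≤ (j : ℝ) / (n.choose 2 : ℕ) := by positivity
    have h2 : ((j : ℝ) / (n.choose 2 : ℕ)) ^ (k.choose 2) ≤ (2 * pc n k) ^ (k.choose 2) :=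
      pow_le_pow_left₀ hq0 hjq _
    have hC0 : (0 : ℝ) ≤ (((n - 2).choose (k - 2) : ℕ) : ℝ) := Nat.cast_nonneg _
    have hF0 : (0 : ℝ) ≤ #F := Nat.cast_nonneg _
    have h3 : (#F : ℝ) * ((n - 2).choose (k - 2) : ℕ) * ((j : ℝ) / (n.choose 2 : ℕ)) ^ (k.choose 2) ≤
        (#F : ℝ) * ((n - 2).choose (k - 2) : ℕ) * (2 * pc n k) ^ (k.choose 2) :=
      mul_le_mul_of_nonneg_left h2 (mul_nonneg hF0 hC0)
    have h4 := touchBudget_sub hn2 hk2 hFcard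
    calc (#((slice n j).filter fun x => Touch n k F x) : ℝ)
        ≤ (#F : ℝ) * ((n - 2).choose (k - 2) : ℕ) * ((j : ℝ) / (n.choose 2 : ℕ)) ^ (k.choose 2) *
            #(slice n j) := h1
      _ ≤ (2 : ℝ) ^ (k.choose 2) * pc n k * #(slice n j) := by
          refine mul_le_mul_of_nonneg_right (h3.trans h4) hS0
      _ ≤ α₀ / 2 * #(slice n j) := mul_le_mul_of_nonneg_right hτn hS0
  -- the slice is non-empty
  have hSpos : (0 : ℝ) < #(slice n j) := by
    have : #(slice n j) = (n.choose 2).choose j := sliceCard_eq n j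
    rw [this]
    exact_mod_cast Nat.choose_pos hjN
  -- assemble: `α₀ S ≤ #err + α₀/2 S` and `#err ≤ α₀/4 S`
  nlinarith

/-! ## The window transfer (registered stub T8 of the reshaped skeleton) -/

/-- **stub T8 `stub_transferWindow`** of line `Sketch-ideator3-r1` (crux stmt-PneNP-2832): T1 (slice touching bound),
T2 (fibre decoupling), the sub-threshold fibre clique bounds T3θ/T4θ (`8·|F| ≤ m_k(n)`), the coincidence tail T5 and the
WINDOWED parity hardness T7′ (circuits with `m_k(n) ≤ 16·size + 8` only) imply `SliceTargetAt c` for every `c ≥ 2`: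
given a `δ_X`-accurate circuit on a central slice, either it is below the window — impossible by the sub-threshold
locality floor (`sliceLB_subthreshold_of`) — or T7′ applies after trading `CLIQUE_k` for `[2 ∤ ω_k]` off the tail
(`#{C ≠ parity} ≤ #errSet + #{ω_k ≥ 2}`), with `δ_X = min ((δ − (1/k!)²)/4) δ_floor`. [folklore] -/
theorem stub_transferWindow :
    (∀ (n k j : ℕ) (F : Finset (Edge n)), k.choose 2 ≤ j → j ≤ n.choose 2 →
      (#((slice n j).filter fun x => Touch n k F x) : ℝ) ≤
        (#F : ℝ) * ((n - 2).choose (k - 2) : ℝ) * (((j : ℝ) / (n.choose 2 : ℕ)) ^ (k.choose 2)) * #(slice n j)) →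
    (∀ (n j : ℕ) (F : Finset (Edge n)) (f g : (Edge n → Bool) → Bool) (α : ℝ),
      (∀ x y : Edge n → Bool, (∀ e ∈ F, x e = y e) → f x = f y) →
      (∀ (ρ : Edge n → Bool) (b : Bool),
        α * #((slice n j).filter fun x => ∀ e ∈ F, x e = ρ e) ≤
          #((slice n j).filter fun x => (∀ e ∈ F, x e = ρ e) ∧ g x = b)) →
      α * #(slice n j) ≤ #((slice n j).filter fun x => f x ≠ g x)) →
    (∀ k : ℕ, 3 ≤ k → ∃ α : ℝ, 0 < α ∧ ∀ᶠ n : ℕ in atTop, ∀ j : ℕ, Central k n j →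
      ∀ F : Finset (Edge n), 8 * #F ≤ thr k n → ∀ ρ : Edge n → Bool,
        α * #((slice n j).filter fun x => ∀ e ∈ F, x e = ρ e) ≤
          #((slice n j).filter fun x => (∀ e ∈ F, x e = ρ e) ∧ cliqueFn n k (zeroOn F x) = true)) →
    (∀ k : ℕ, 3 ≤ k → ∀ᶠ n : ℕ in atTop, ∀ j : ℕ, Central k n j →
      ∀ F : Finset (Edge n), 8 * #F ≤ thr k n → ∀ ρ : Edge n → Bool,
        (1 / 2 : ℝ) * #((slice n j).filter fun x => ∀ e ∈ F, x e = ρ e) ≤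
          #((slice n j).filter fun x => (∀ e ∈ F, x e = ρ e) ∧ cliqueFn n k (zeroOn F x) = false)) →
    (∀ k : ℕ, 3 ≤ k → ∀ ε : ℝ, 0 < ε → ∀ᶠ n : ℕ in atTop, ∀ j : ℕ, Central k n j →
      (#((slice n j).filter fun x => 2 ≤ cliqueCount n k x) : ℝ) ≤
        ((1 / (k.factorial : ℝ)) ^ 2 / 2 + ε) * #(slice n j)) →
    (∀ c : ℕ, 2 ≤ c → ∃ k : ℕ, 3 ≤ k ∧ ∃ δ : ℝ, (1 / (k.factorial : ℝ)) ^ 2 < δ ∧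
      ∀ᶠ n : ℕ in atTop, ∀ j : ℕ, Central k n j → ∀ C : Circuit (Edge n), C.IsOver monotoneBasis →
        thr k n ≤ 16 * C.size + 8 →
        (#((slice n j).filter fun x => C.eval x ≠ decide (¬ 2 ∣ cliqueCount n k x)) : ℝ) ≤ δ * #(slice n j) →
          n ^ c < C.size) →
    ∀ c : ℕ, 2 ≤ c → ∃ k : ℕ, 3 ≤ k ∧ ∃ δ : ℝ, 0 < δ ∧
      ∀ᶠ n : ℕ in atTop, ∀ j : ℕ, Central k n j → ∀ C : Circuit (Edge n), C.IsOver monotoneBasis →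
        (#(errSet n k j C) : ℝ) ≤ δ * #(slice n j) → n ^ c < C.size := by
  intro hTouch hFib hLow hUp hTail hPar c hc
  obtain ⟨k, hk, δ, hδ, hP⟩ := hPar c hc
  obtain ⟨δf, hδf, hfloor⟩ := sliceLB_subthreshold_of hTouch hFib hLow hUp hk
  set t : ℝ := (1 / (k.factorial : ℝ)) ^ 2 with ht
  have ht0 : 0 ≤ t := by positivity
  set ε : ℝ := (δ - t) / 4 with hε
  have hε0 : 0 < ε := by rw [hε]; linarith
  set δX : ℝ := min ε δf with hδX
  have hδX0 : 0 < δX := lt_min hε0 hδf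
  refine ⟨k, hk, δX, hδX0, ?_⟩
  filter_upwards [hTail k hk ε hε0, hP, hfloor] with n hT hPn hfl
  intro j hj C hC herr
  have hS0 : (0 : ℝ) ≤ #(slice n j) := Nat.cast_nonneg _
  have herrε : (#(errSet n k j C) : ℝ) ≤ ε * #(slice n j) :=
    herr.trans (mul_le_mul_of_nonneg_right (min_le_left _ _) hS0)
  have herrf : (#(errSet n k j C) : ℝ) ≤ δf * #(slice n j) :=
    herr.trans (mul_le_mul_of_nonneg_right (min_le_right _ _) hS0)
  have hwin : thr k n ≤ 16 * C.size + 8 := hfl j hj C hC herrf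
  apply hPn j hj C hC hwin
  -- `{C ≠ parity} ⊆ errSet ∪ {ω ≥ 2}`
  have hsub : ((slice n j).filter fun x => C.eval x ≠ decide (¬ 2 ∣ cliqueCount n k x)) ⊆
      errSet n k j C ∪ (slice n j).filter fun x => 2 ≤ cliqueCount n k x := by
    intro x hx
    rw [mem_filter] at hx
    obtain ⟨hxs, hne⟩ := hx
    rw [mem_union]
    by_cases h2 : 2 ≤ cliqueCount n k x
    · exact Or.inr (mem_filter.2 ⟨hxs, h2⟩)
    · left
      refine mem_filter.2 ⟨mem_univ _, (mem_filter.1 hxs).2, ?_⟩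
      -- off the tail the clique indicator IS the parity of the clique count
      have hpar : cliqueFn n k x = decide (¬ 2 ∣ cliqueCount n k x) := by
        by_cases h0 : cliqueCount n k x = 0
        · rw [(cliqueCount_eq_zero_iff x).1 h0, h0]
          decide
        · have h1 : cliqueCount n k x = 1 := by omega
          rw [(cliqueCount_ne_zero_iff x).1 h0, h1]
          decide
      rwa [hpar]
  have hcard : (#((slice n j).filter fun x => C.eval x ≠ decide (¬ 2 ∣ cliqueCount n k x)) : ℝ) ≤
      #(errSet n k j C) + #((slice n j).filter fun x => 2 ≤ cliqueCount n k x) := by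
    have := (card_le_card hsub).trans (card_union_le _ _)
    exact_mod_cast this
  have hδε : ε + (t / 2 + ε) ≤ δ := by rw [hε]; linarith
  calc (#((slice n j).filter fun x => C.eval x ≠ decide (¬ 2 ∣ cliqueCount n k x)) : ℝ)
      ≤ #(errSet n k j C) + #((slice n j).filter fun x => 2 ≤ cliqueCount n k x) := hcard
    _ ≤ ε * #(slice n j) + (t / 2 + ε) * #(slice n j) := add_le_add herrε (hT j hj)
    _ = (ε + (t / 2 + ε)) * #(slice n j) := by ring
    _ ≤ δ * #(slice n j) := mul_le_mul_of_nonneg_right hδε hS0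

end

end Summit.PneNP.PneNP.Cruxes.SliceTarget.Ideator3Line
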